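import Literature.NumberTheory.LFunctions.KeiperPowerSeriesProofs
import Literature.NumberTheory.LFunctions.KeiperPowerSeriesTailsProofs
import HarnessLib

/-!
# Keiper 1992, §5 p.769: «RH ⟺ the `τ_k` are bounded» — assembled as one tree theorem

LINE 1 — FRAMING: RH-EQUIVALENT as printed, PROVED AS AN EQUIVALENCE (neither side asserted).  Cell
rh-crit, corpus C2/dbl, row «dbl:W2-Ke92» closer; bears_on: L-C/L-P (COLUMN 4, Li).  WHAT THIS IS NOT:
a criterion is not a proof; nothing here bears on the truth of the Riemann Hypothesis.

[Keiper1992] p.769, after (36): «From (33) it is clear that the Riemann hypothesis implies that the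
values of |τ_k| are bounded by Σ_ρ |ρ|^{−2} = 0.0461914179… Conversely, if the |τ_k| are bounded, then
by (19) the Riemann hypothesis must be true.»  Both directions are tree theorems
(`Keiper1992_eq36_holds`, this seat; `Keiper1992_rh_of_tau_bounded_holds`, dbl-t6); this file only
assembles the printed equivalence, with Keiper's explicit RH-bound `Σ_ρ m(ρ)/|ρ|²` (which under RH is
Nicolas's `β = 2 + γ − log π − 2 log 2`, tree `tsum_order_div_norm_sq_eq_nicolasBeta_of_rh`).
Theorems only; no definitions, no named facts.

## References
* J. B. Keiper, *Power series expansions of Riemann's ξ function*, Math. Comp. 58 (1992) 765–773. [Keiper1992]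
-/

noncomputable section

namespace Literature.NumberTheory.LFunctions

/-- **[Keiper1992] §5 p.769 — the τ-criterion**: `RH ⟺ (|τ_k|)_k is bounded`, where
`ξ'(1/s)/ξ(1/s) = Σ τ_k (1 − s)^k` (19).  (⟹) is (36) (`Keiper1992_eq36_holds`, bound
`Σ_ρ m(ρ)/|ρ|²`); (⟸) is «by (19)» (`Keiper1992_rh_of_tau_bounded_holds`).  RH-EQUIVALENT as printed,
proved as an equivalence; neither side is asserted. [cite: Keiper1992, p.769 (after eq. (36))] -/
theorem Keiper1992_rh_iff_tau_bounded :
    RiemannHypothesis ↔ ∃ C : ℝ, ∀ k : ℕ, |keiperTau k| ≤ C :=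
  ⟨fun hRH ↦ ⟨_, Keiper1992_eq36_holds hRH⟩, fun h ↦ Keiper1992_rh_of_tau_bounded_holds h⟩

/-- **[Keiper1992] (36) with Keiper's printed constant**: under RH, `|τ_k| ≤ β = 2 + γ − log π − 2 log 2`
(`= 0.0461914179…`, Nicolas's constant, tree `nicolasBeta`), since `Σ_ρ m(ρ)/|ρ|² = β` on the critical
line (`tsum_order_div_norm_sq_eq_nicolasBeta_of_rh`).  RH-CONSEQUENCE with explicit binder; nothing is
asserted unconditionally. [cite: Keiper1992, eq. (36) p.769] -/
theorem Keiper1992_eq36_nicolasBeta (hRH : RiemannHypothesis) (k : ℕ) :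
    |keiperTau k| ≤ nicolasBeta := by
  have h := Keiper1992_eq36_holds hRH k
  rwa [tsum_order_div_norm_sq_eq_nicolasBeta_of_rh hRH] at h

end Literature.NumberTheory.LFunctions
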